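import Literature.AlgebraicGeometry.Resolution.AffineDomainDimension
import Mathlib.Algebra.MonoidAlgebra.Basic
import Mathlib.RingTheory.KrullDimension.Polynomial
import Mathlib.RingTheory.KrullDimension.Field
import HarnessLib

/-!
# Toric surface programme: `k[σ∨ ∩ ℤ²]` has Krull dimension 2

Support file for crux stmt-ResolutionOfSingularities-15317 (`FrobeniusLadder.FRationalResolution`),
line `redirect`, lead c4 (toric surface programme for rung 4′: all affine toric surfaces
`U(r,a) = Spec k[{m ∈ ℤ² : 0 ≤ m₂, a m₂ ≤ r m₁}]` over every field lie in the crux's residual class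
and are resolved by the Hirzebruch–Jung tower; this file certifies that they are SURFACES).

For `1 ≤ r` the toric algebra `TA[r,a] = k[σ∨ ∩ ℤ²] ⊆ k[ℤ²]`, `σ∨ = {m₂ ≥ 0, a m₂ ≤ r m₁}`, has
Krull dimension `2`:

* `toric_aeval_xw_injective` — the substitution `X₀ ↦ x = χ^(1,0)`, `X₁ ↦ w = χ^(a,r)`,
  `k[X₀, X₁] → k[ℤ²]`, is the domain change `mapDomain φ` along the exponent map
  `φ(d) = d₀ (1,0) + d₁ (a,r)`, `ℕ² → ℤ²`, an injective (as `r ≥ 1`) monoid homomorphism, hence is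
  injective (the monomials `xⁱ wʲ` are pairwise distinct characters): `k[x, w] ⊆ TA[r,a]` is a
  polynomial ring in two variables;
* `toric_single_pow_eq` — every cone monomial is integral over `k[x, w]`:
  `(χ^m)^r = x^(r m₁ − a m₂) w^(m₂)` for `m ∈ σ∨ ∩ ℤ²`;
* `stub_toric_ringKrullDim` — `TA[r,a]` is integral over the polynomial ring `k[x, w]`
  (generated by integral elements), and Krull dimension is invariant under injective integral
  extensions (`Literature.AlgebraicGeometry.Resolution.ringKrullDim_eq_of_isIntegral`), so
  `dim TA[r,a] = dim k[X₀, X₁] = 2`.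

All folklore (Cox–Little–Schenck 2011, §1.2; Matsumura Thm. 9.4, Thm. 5.6); no published fact is
used beyond the tree lemma.
-/

-- single-problem summit: the doubled namespace component is forced
set_option linter.dupNamespace false

noncomputable section

namespace Summit.ResolutionOfSingularities.ResolutionOfSingularities.Theorems.FRationalResolution

open CategoryTheory AlgebraicGeometry TopologicalSpace
open Literature.AlgebraicGeometry.Resolution

section Toric

variable (k : Type) [Field k]

/-- The Laurent polynomial ring `k[ℤ²]` (coordinate ring of the 2-torus). -/
local notation3 "Lk" => AddMonoidAlgebra k (ℤ × ℤ)

/-- The lattice points of the dual cone `σ∨ = {m₂ ≥ 0, a m₂ ≤ r m₁}` of `σ = cone((0,1),(r,-a))`. -/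
local notation3 "σS[" r ", " a "]" =>
  {m : ℤ × ℤ | 0 ≤ m.2 ∧ ((a : ℕ) : ℤ) * m.2 ≤ ((r : ℕ) : ℤ) * m.1}

/-- The toric surface algebra `k[σ∨ ∩ ℤ²] ⊆ k[ℤ²]`. -/
local notation3 "TA[" r ", " a "]" =>
  Algebra.adjoin k ((fun m : ℤ × ℤ => AddMonoidAlgebra.single m (1 : k)) '' σS[r, a])

/-- The substitution `X₀ ↦ x = χ^(1,0)`, `X₁ ↦ w = χ^(a,r)`, `k[X₀, X₁] → k[ℤ²]`, is injective for
`1 ≤ r`: it is the domain change `mapDomain φ` along the exponent map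
`φ(d) = d₀ • (1,0) + d₁ • (a,r) = (d₀ + a d₁, r d₁)`, an injective (as `r ≥ 1`) additive monoid
homomorphism `ℕ² → ℤ²` — the monomials `xⁱ wʲ = χ^(i + a j, r j)` are pairwise distinct characters.
[folklore] -/
theorem toric_aeval_xw_injective (r a : ℕ) (hr : 1 ≤ r) :
    Function.Injective
      (MvPolynomial.aeval
        ![AddMonoidAlgebra.single (((1 : ℤ), (0 : ℤ)) : ℤ × ℤ) (1 : k),
          AddMonoidAlgebra.single ((((a : ℕ) : ℤ), ((r : ℕ) : ℤ)) : ℤ × ℤ) (1 : k)] :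
        MvPolynomial (Fin 2) k →ₐ[k] Lk) := by
  -- the exponent map `φ(d) = (d₀ + a d₁, r d₁)`
  let φ : (Fin 2 →₀ ℕ) →+ ℤ × ℤ :=
    { toFun := fun d => (((d 0 : ℕ) : ℤ) + (a : ℤ) * ((d 1 : ℕ) : ℤ), (r : ℤ) * ((d 1 : ℕ) : ℤ))
      map_zero' := by simp
      map_add' := fun d e => by
        simp only [Finsupp.coe_add, Pi.add_apply, Nat.cast_add, Prod.mk_add_mk, Prod.mk.injEq]
        constructor <;> ring }
  have hφ : ∀ d, φ d = (((d 0 : ℕ) : ℤ) + (a : ℤ) * ((d 1 : ℕ) : ℤ), (r : ℤ) * ((d 1 : ℕ) : ℤ)) :=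
    fun d => rfl
  -- `φ` is injective since `r ≥ 1`
  have hφinj : Function.Injective φ := by
    intro d e hde
    rw [hφ, hφ, Prod.mk.injEq] at hde
    obtain ⟨h0, h1⟩ := hde
    have hr0 : (r : ℤ) ≠ 0 := by exact_mod_cast (by omega : r ≠ 0)
    have he1 : ((d 1 : ℕ) : ℤ) = e 1 := mul_left_cancel₀ hr0 h1
    have he0 : ((d 0 : ℕ) : ℤ) = e 0 := by rw [he1] at h0; linarith
    ext i
    fin_cases i
    · exact_mod_cast he0
    · exact_mod_cast he1
  -- the substitution is `mapDomain φ` (check on the variables `X₀`, `X₁`)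
  have heq : (MvPolynomial.aeval
        ![AddMonoidAlgebra.single (((1 : ℤ), (0 : ℤ)) : ℤ × ℤ) (1 : k),
          AddMonoidAlgebra.single ((((a : ℕ) : ℤ), ((r : ℕ) : ℤ)) : ℤ × ℤ) (1 : k)] :
        MvPolynomial (Fin 2) k →ₐ[k] Lk) =
      AddMonoidAlgebra.mapDomainAlgHom k k φ := by
    apply MvPolynomial.algHom_ext
    intro i
    rw [MvPolynomial.aeval_X, AddMonoidAlgebra.mapDomainAlgHom_apply, MvPolynomial.X,
      ← MvPolynomial.single_eq_monomial, AddMonoidAlgebra.mapDomain_single, hφ]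
    fin_cases i
    · simp
    · simp
  rw [heq]
  exact AddMonoidAlgebra.mapDomain_injective hφinj

/-- The integral relation of a cone monomial over `k[x, w]`: for `m ∈ σ∨ ∩ ℤ²`,
`(χ^m)^r = x^(r m₁ − a m₂) · w^(m₂)` in `k[ℤ²]` (`r m = (r m₁ − a m₂)(1,0) + m₂ (a,r)` with both
coefficients nonnegative). [folklore] -/
theorem toric_single_pow_eq (r a : ℕ) (m : ℤ × ℤ) (hm : m ∈ σS[r, a]) :
    AddMonoidAlgebra.single m (1 : k) ^ r =
      AddMonoidAlgebra.single (((1 : ℤ), (0 : ℤ)) : ℤ × ℤ) (1 : k) ^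
          (((r : ℕ) : ℤ) * m.1 - ((a : ℕ) : ℤ) * m.2).toNat *
        AddMonoidAlgebra.single ((((a : ℕ) : ℤ), ((r : ℕ) : ℤ)) : ℤ × ℤ) (1 : k) ^ m.2.toNat := by
  obtain ⟨hm0, hmc⟩ := hm
  have hi : ((((r : ℕ) : ℤ) * m.1 - ((a : ℕ) : ℤ) * m.2).toNat : ℤ) =
      (r : ℤ) * m.1 - (a : ℤ) * m.2 :=
    Int.toNat_of_nonneg (by linarith)
  have hj : ((m.2.toNat : ℕ) : ℤ) = m.2 := Int.toNat_of_nonneg hm0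
  rw [AddMonoidAlgebra.single_pow, AddMonoidAlgebra.single_pow, AddMonoidAlgebra.single_pow,
    AddMonoidAlgebra.single_mul_single, one_pow, one_pow, one_pow, mul_one]
  congr 1
  refine Prod.ext ?_ ?_
  · show r • m.1 = (((r : ℕ) : ℤ) * m.1 - ((a : ℕ) : ℤ) * m.2).toNat • (1 : ℤ) + m.2.toNat • (a : ℤ)
    rw [nsmul_eq_mul, nsmul_eq_mul, nsmul_eq_mul, hi, hj]
    ring
  · show r • m.2 = (((r : ℕ) : ℤ) * m.1 - ((a : ℕ) : ℤ) * m.2).toNat • (0 : ℤ) + m.2.toNat • (r : ℤ)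
    rw [nsmul_eq_mul, nsmul_eq_mul, nsmul_eq_mul, hj]
    ring

/-- STUB (the toric algebra is a surface): for `1 ≤ r` (and `a ≤ r`, not needed) the toric surface
algebra `TA[r,a] = k[σ∨ ∩ ℤ²]` has Krull dimension `2`. The polynomial ring `k[X₀, X₁]` embeds as
`k[x, w]`, `x = χ^(1,0)`, `w = χ^(a,r)` (`toric_aeval_xw_injective`), every generator `χ^m`,
`m ∈ σ∨ ∩ ℤ²`, satisfies `(χ^m)^r = x^(r m₁ − a m₂) w^(m₂)` (`toric_single_pow_eq`), so `TA[r,a]` is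
integral over `k[X₀, X₁]` along an injective structure map, and Krull dimension is invariant under
injective integral extensions (`ringKrullDim_eq_of_isIntegral`): `dim TA[r,a] = dim k[X₀, X₁] = 2`.
[folklore; CLS2011 §1.2, Matsumura1987 Thm. 9.4 / 5.6] -/
theorem stub_toric_ringKrullDim (r a : ℕ) (hr : 1 ≤ r) (har : a ≤ r) : ringKrullDim ↥TA[r, a] = 2 := by
  have _ := har
  -- the generators `x = χ^(1,0)`, `w = χ^(a,r)` lie in the cone algebra
  have hx : AddMonoidAlgebra.single (((1 : ℤ), (0 : ℤ)) : ℤ × ℤ) (1 : k) ∈ TA[r, a] :=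
    Algebra.subset_adjoin ⟨_, ⟨le_rfl, by simp⟩, rfl⟩
  have hw : AddMonoidAlgebra.single ((((a : ℕ) : ℤ), ((r : ℕ) : ℤ)) : ℤ × ℤ) (1 : k) ∈ TA[r, a] :=
    Algebra.subset_adjoin ⟨_, ⟨Nat.cast_nonneg r, (mul_comm _ _).le⟩, rfl⟩
  -- the structure map `g : k[X₀, X₁] → TA[r,a]`, `X₀ ↦ x`, `X₁ ↦ w`
  set v : Fin 2 → ↥TA[r, a] := ![⟨_, hx⟩, ⟨_, hw⟩] with hv
  set g : MvPolynomial (Fin 2) k →ₐ[k] ↥TA[r, a] := MvPolynomial.aeval v with hg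
  have hval : (Algebra.adjoin k _).val.comp g =
      (MvPolynomial.aeval
        ![AddMonoidAlgebra.single (((1 : ℤ), (0 : ℤ)) : ℤ × ℤ) (1 : k),
          AddMonoidAlgebra.single ((((a : ℕ) : ℤ), ((r : ℕ) : ℤ)) : ℤ × ℤ) (1 : k)] :
        MvPolynomial (Fin 2) k →ₐ[k] Lk) := by
    apply MvPolynomial.algHom_ext
    intro i
    rw [AlgHom.comp_apply, hg, MvPolynomial.aeval_X, MvPolynomial.aeval_X]
    fin_cases i <;> simp [hv]
  have hginj : Function.Injective g := by
    have h := toric_aeval_xw_injective k r a hr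
    rw [← hval, AlgHom.coe_comp] at h
    exact h.of_comp
  letI : Algebra (MvPolynomial (Fin 2) k) ↥TA[r, a] := g.toRingHom.toAlgebra
  haveI : IsScalarTower k (MvPolynomial (Fin 2) k) ↥TA[r, a] :=
    IsScalarTower.of_algebraMap_eq fun c => (g.commutes c).symm
  -- every cone monomial is integral over `k[X₀, X₁]`: `(χ^m)^r = g (X₀^i X₁^j)`
  have hgen : ∀ y : ↥TA[r, a],
      (y : Lk) ∈ (fun m : ℤ × ℤ => AddMonoidAlgebra.single m (1 : k)) '' σS[r, a] →
        IsIntegral (MvPolynomial (Fin 2) k) y := by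
    rintro y ⟨m, hm, hym⟩
    refine IsIntegral.of_pow (Nat.lt_of_lt_of_le Nat.zero_lt_one hr) ?_
    have hyr : y ^ r = algebraMap (MvPolynomial (Fin 2) k) ↥TA[r, a]
        (MvPolynomial.X 0 ^ (((r : ℕ) : ℤ) * m.1 - ((a : ℕ) : ℤ) * m.2).toNat *
          MvPolynomial.X 1 ^ m.2.toNat) := by
      apply Subtype.ext
      change ((y ^ r : ↥TA[r, a]) : Lk) = ((g _ : ↥TA[r, a]) : Lk)
      rw [hg, map_mul, map_pow, map_pow, MvPolynomial.aeval_X, MvPolynomial.aeval_X]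
      simp only [hv, Matrix.cons_val_zero, Matrix.cons_val_one, Subalgebra.coe_pow,
        Subalgebra.coe_mul]
      rw [← hym]
      exact toric_single_pow_eq k r a m hm
    rw [hyr]
    exact isIntegral_algebraMap
  haveI : Algebra.IsIntegral (MvPolynomial (Fin 2) k) ↥TA[r, a] := by
    refine ⟨fun y => ?_⟩
    have hle : Algebra.adjoin k (((↑) : ↥TA[r, a] → Lk) ⁻¹'
        ((fun m : ℤ × ℤ => AddMonoidAlgebra.single m (1 : k)) '' σS[r, a])) ≤
        (integralClosure (MvPolynomial (Fin 2) k) ↥TA[r, a]).restrictScalars k :=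
      Algebra.adjoin_le fun z hz => hgen z hz
    rw [Algebra.adjoin_adjoin_coe_preimage] at hle
    exact hle Algebra.mem_top
  have hinj : Function.Injective (algebraMap (MvPolynomial (Fin 2) k) ↥TA[r, a]) := hginj
  rw [ringKrullDim_eq_of_isIntegral hinj, MvPolynomial.ringKrullDim_of_isNoetherianRing,
    ringKrullDim_eq_zero_of_field, Nat.card_eq_fintype_card, Fintype.card_fin, zero_add]
  rfl

end Toric

end Summit.ResolutionOfSingularities.ResolutionOfSingularities.Theorems.FRationalResolution

end
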